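import Mathlib
import Summits.ValiantsHypothesis.ValiantsHypothesis.Theorems.DivisionGapPerDivisionHardPerPowers

/-!
# `DivisionGap.PerCofactorDegreeReduction` (stmt-ValiantsHypothesis-15046), line `Sketch_ideator4`:
pure-rich classes of constant margins (stub `stub_pureCountRung`, X)

The sibling line's typed vertex count `PerDivisionHard.card_pure_mul_two_pow_le` (the engine of the
powers rung `perPow_complexity_lower`) in this line's currency, i.e. directly in terms of
`L⁺(per_n · h)`.  If every monomial of the cofactor `h ∈ ℝ≥0[x_ij]` has all row sums and all
column sums `d`, then

* every monomial of `F = per_n · h` has all row and column sums `d + 1`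
  (`supp (per · h) ⊆ supp per + supp h`, permutation monomials have unit margins; `margins_perMul`);
* every pure table `d • μ_π ∈ supp h` gives the pure table `(d + 1) • μ_π = μ_π + d • μ_π ∈ supp F`
  (over `ℝ≥0` nothing cancels, `add_mem_support_mul`; `succ_smul_permMonomial_mem_support_perMul`),

so a size-optimal fan-in-two circuit for `F` (`exists_computes_size_eq_complexity`) exhibits at most
`L⁺(F) · n!/2^{⌊n/3⌋}` of them (`card_pure_mul_two_pow_le` with `M = d + 1 ≥ 1`, `N = L⁺(F)`):
`#{π : d • μ_π ∈ supp h} · 2^{⌊n/3⌋} ≤ L⁺(per_n · h) · n!` for `n ≥ 3`.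

No definitions in this file. [folklore]
-/

noncomputable section

-- `Summit.ValiantsHypothesis.ValiantsHypothesis.…` is the tree's mandated single-conjunct layout
-- (Sub = Summit), so the duplicated namespace component is intended.
set_option linter.dupNamespace false

open MvPolynomial Literature.Computability.AlgebraicComplexity
open Literature.Computability.AlgebraicComplexity.ArithCircuit
open Literature.Barriers.ValiantsHypothesis
open scoped NNReal Pointwise

namespace Summit.ValiantsHypothesis.ValiantsHypothesis.Theorems.DivisionGap.PerCofactorDegreeReduction.PureCountRung

/-- **Margins of `per_n · h` for constant margins.**  If every monomial of `h` has all row sums and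
all column sums `d`, then every monomial of `per_n · h` has all row sums and all column sums
`d + 1` (`supp (per · h) ⊆ supp per + supp h`, the monomials of `per` are the permutation
monomials, and these have unit margins). [folklore] -/
theorem margins_perMul {n d : ℕ} {h : MvPolynomial (Fin n × Fin n) ℝ≥0}
    (hd : ∀ m ∈ h.support, (∀ i, ∑ j, m (i, j) = d) ∧ (∀ j, ∑ i, m (i, j) = d)) :
    ∀ α ∈ (perPoly (Fin n) ℝ≥0 * h).support,
      (∀ i, ∑ j, α (i, j) = d + 1) ∧ (∀ j, ∑ i, α (i, j) = d + 1) := by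
  classical
  intro α hα
  obtain ⟨u, hu, m, hm, rfl⟩ := Finset.mem_add.mp (support_mul _ _ hα)
  obtain ⟨σ, rfl⟩ := exists_permMonomial_eq_of_coeff_perPoly_ne_zero ℝ≥0 (mem_support_iff.mp hu)
  obtain ⟨hr, hc⟩ := hd m hm
  refine ⟨fun i => ?_, fun j => ?_⟩
  · have h1 : ∑ j, permMonomial σ (i, j) = 1 := rowCount_permMonomial σ i
    simp only [Finsupp.coe_add, Pi.add_apply, Finset.sum_add_distrib, h1, hr i]
    omega
  · have h1 : ∑ i, permMonomial σ (i, j) = 1 := colCount_permMonomial σ j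
    simp only [Finsupp.coe_add, Pi.add_apply, Finset.sum_add_distrib, h1, hc j]
    omega

/-- **Pure tables through `· per_n`.**  If the pure table `d • μ_π` occurs in `h`, then the pure
table `(d + 1) • μ_π = μ_π + d • μ_π` occurs in `per_n · h`: over `ℝ≥0` nothing cancels
(`add_mem_support_mul`) and `μ_π` has coefficient `1` in `per_n`. [folklore] -/
theorem succ_smul_permMonomial_mem_support_perMul {n d : ℕ}
    {h : MvPolynomial (Fin n × Fin n) ℝ≥0} (π : Equiv.Perm (Fin n))
    (hπ : d • permMonomial π ∈ h.support) :
    (d + 1) • permMonomial π ∈ (perPoly (Fin n) ℝ≥0 * h).support := by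
  classical
  rw [succ_nsmul']
  refine Literature.Barriers.ValiantsHypothesis.add_mem_support_mul ?_ hπ
  rw [mem_support_iff, coeff_permMonomial_perPoly]
  exact one_ne_zero

/-- **Stub X (pure-rich classes of constant margins) of line `Sketch_ideator4`: the typed vertex
count in this line's currency.**  If every monomial of `h ∈ ℝ≥0[x_ij]` (`n ≥ 3`) has all row
sums and all column sums `d`, then the permutations `π` whose pure table `d • μ_π` occurs in `h`
number at most `L⁺(per_n · h) · n!/2^{⌊n/3⌋}`: they inject into the pure tables `(d + 1) • μ_π`
of `per_n · h` (`succ_smul_permMonomial_mem_support_perMul`), whose monomials all have margins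
`d + 1` (`margins_perMul`), and a size-optimal fan-in-two circuit for `per_n · h`
(`exists_computes_size_eq_complexity`) exhibits at most `L⁺ · n!/2^{⌊n/3⌋}` of those
(`PerDivisionHard.card_pure_mul_two_pow_le`, after Jerrum–Snir). [folklore] -/
theorem stub_pureCountRung :
    ∀ (n d : ℕ) (h : MvPolynomial (Fin n × Fin n) ℝ≥0), 3 ≤ n →
      (∀ m ∈ h.support, (∀ i, ∑ j, m (i, j) = d) ∧ (∀ j, ∑ i, m (i, j) = d)) →
      ((Finset.univ : Finset (Equiv.Perm (Fin n))).filter fun π =>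
          d • permMonomial π ∈ h.support).card * 2 ^ (n / 3) ≤
        complexity (perPoly (Fin n) ℝ≥0 * h) * Nat.factorial n := by
  classical
  intro n d h hn hd
  obtain ⟨P, h2, hP, hsize⟩ := exists_computes_size_eq_complexity (perPoly (Fin n) ℝ≥0 * h)
  have heval : P.eval = perPoly (Fin n) ℝ≥0 * h := hP
  have hZ : ∃ Z : Finset ℕ, Z.card ≤ P.size ∧ ∀ j ∉ Z, (gateValues P.gates).getD j 0 = 0 := by
    refine ⟨Finset.range P.size, by simp, fun j hj => getD_gateValues_eq_zero ?_⟩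
    exact List.getElem?_eq_none_iff.mpr (by simpa [ArithCircuit.size] using hj)
  have hcount :=
    Summit.ValiantsHypothesis.ValiantsHypothesis.Theorems.DivisionGapPerDivisionHard.card_pure_mul_two_pow_le
      n (d + 1) P.size P hn (Nat.succ_pos d) h2 hZ (by rw [heval]; exact margins_perMul hd)
  have hsub : ((Finset.univ : Finset (Equiv.Perm (Fin n))).filter fun π =>
        d • permMonomial π ∈ h.support) ⊆
      (Finset.univ.filter fun π : Equiv.Perm (Fin n) =>
        (d + 1) • permMonomial π ∈ P.eval.support) := by
    intro π hπ
    simp only [Finset.mem_filter, Finset.mem_univ, true_and] at hπ ⊢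
    rw [heval]
    exact succ_smul_permMonomial_mem_support_perMul π hπ
  rw [hsize] at hcount
  exact (Nat.mul_le_mul_right _ (Finset.card_le_card hsub)).trans hcount

end Summit.ValiantsHypothesis.ValiantsHypothesis.Theorems.DivisionGap.PerCofactorDegreeReduction.PureCountRung

end
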